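import Literature.AlgebraicGeometry.Modules.CechOrderedRefinementComparison
import Literature.AlgebraicGeometry.Modules.ModuleCechPrune
import HarnessLib

/-!
# Cover independence of the ordered module Čech cohomology `Ȟⁿ(𝓤, M)`: refinement, common refinement, and transport along `M ≅ M′`
# (The Stacks Project, Tags 01FG, 01XD; Görtz–Wedhorn II Thm. 22.9; Hartshorne III Lemma 4.4, Thm. 4.5)

Layer `Literature/AlgebraicGeometry/Modules`, namespace `Literature.AlgebraicGeometry.Modules`.  PROOF file (theorems only; no definition,
no named fact, no instance, no notation, no `sorry`).  Cell `hodgecm-mathlib` (D-0151), pay-down programme «H1-DIM in char `p`» (F0P6 RULING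
«M-25» (2)), file **(C)** of the D1 road «`H^i(A, M) = 0` for `M ∈ Pic⁰ ∖ 0`» ([MumfordAV1970] §8 (vii)); consumed there to compare the
Čech cohomologies of ONE module on the two product covers `{p₁⁻¹U_i ∩ p₂⁻¹U_j}` and `{p₁⁻¹U_i ∩ m⁻¹U_l}` of `A × A` through their
common refinement (the triple cover of the F-J3b files).

For a scheme `X : Scheme.{0}`, an `𝒪_X`-module `M`, a base ring `ρ : A → Γ(X, 𝒪_X)` and finite linearly ordered families of opens
(★ `Modules/ModuleCechComplex`: `Ȟⁿ(𝓤, M) := Hⁿ(Modules.cechComplex 𝓤 M ρ)`, an `A`-module):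

* §1 **`exists_sectionsSystem_restrictionHom`** — for `𝓥` refining `𝓤` along ANY index map `θ` (`V_j ≤ U_{θ j}`), the RESTRICTION DATUM
  `φ : θ^*S_𝓤(M) ⟶ S_𝓥(M)` exists (components `x ↦ x|_{V_{s′}}`; the module twin of ★ `pullbackSystemHom (𝟙 X)`, which is the case
  `M = 𝒪_X`) — the characterised `φ`/`hφ` of ★ (G5-c) `Modules.homologyMap_bijective_of_refineCochain`;
* §2 **`nonempty_homology_linearEquiv_of_refines`** — if both families cover `X` and have AFFINE non-empty finite intersections and `M` is
  affine-localizing (quasi-coherent), the refinement map is an `A`-linear isomorphism `Ȟⁿ(𝓤, M) ≃ Ȟⁿ(𝓥, M)` for every `n : ℤ` (★ (G5-c) on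
  ★ `OrderedCech.refineComplexMap θ φ`); `subsingleton_homology_iff_of_refines`;
* §3 **`nonempty_homology_linearEquiv_of_common_refinement`** — two such covers `𝓤`, `𝓤′` admitting a COMMON REFINEMENT `𝓦` of the same kind
  have isomorphic `Ȟⁿ(–, M)` (Hartshorne III Lemma 4.4 ∕ Thm. 4.5: both compute `Hⁿ(X, M)`); with ★ `Modules.sectionsSystemIsoOfIso`
  (`Č(𝓤′, M) ≅ Č(𝓤′, M′)` for `M ≅ M′`) also **`nonempty_homology_linearEquiv_of_iso_of_common_refinement`**:
  `Ȟⁿ(𝓤, M) ≃ₗ[A] Ȟⁿ(𝓤′, M′)`, and the `Subsingleton` transfer `subsingleton_homology_of_iso_of_common_refinement`.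

The common refinement is a BINDER (with its two admissible index maps and its own Leray hypothesis), so no separatedness hypothesis on `X`
is needed here; for a separated `X` the pairwise intersections `U_i ∩ U′_j` always qualify.

HC_CM is proved only modulo the 7 printed citations until rung 0 closes — nothing here bears on a summit statement.

## References
* [StacksProject] The Stacks Project, Tag 01FG (Čech complexes and refinements), Tag 01XD (Čech cohomology of quasi-coherent modules on
  affine-intersection covers computes cohomology).
* [GortzWedhorn2023] U. Görtz, T. Wedhorn, *Algebraic Geometry II* (2023), Def. 21.68 (p. 180), Thm. 22.9 (p. 236).
* [Hartshorne1977] R. Hartshorne, *Algebraic Geometry*, GTM 52 (1977), III Lemma 4.4 and Thm. 4.5 (pp. 220–222).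
* [MumfordAV1970] D. Mumford, *Abelian Varieties* (1970), §8 (vii) (p. 76) (the consumer).
-/

set_option backward.isDefEq.respectTransparency false -- `ModuleCat`-valued functors (as in ★ `OrderedCechSystem`, ★ (G5-c))

noncomputable section

open CategoryTheory CategoryTheory.Limits AlgebraicGeometry TopologicalSpace Opposite
open Literature.Algebra.Homology

namespace Literature.AlgebraicGeometry.Modules

variable {X : Scheme.{0}} {ι ι' : Type} [LinearOrder ι] [LinearOrder ι'] (U : ι → X.Opens) (V : ι' → X.Opens)
  (M : X.Modules) {A : Type} [CommRing A] (ρ : A →+* Γ(X, ⊤)) (θ : ι' → ι) (hV : ∀ j, V j ≤ U (θ j))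

/-! ## §1 The restriction datum of a refinement, for a module -/

omit [LinearOrder ι'] in
include hV in
/-- **The restriction datum `φ : θ^*S_𝓤(M) ⟶ S_𝓥(M)` of a refinement, for an `𝒪_X`-module `M`**: for `V_j ≤ U_{θ j}` there is a
morphism of Čech systems `(s′ ↦ Γ(M, U_{θ(s′)})) ⟶ (s′ ↦ Γ(M, V_{s′}))` whose components ARE the restrictions `x ↦ x|_{V_{s′}}` (naturality =
restrictions compose).  This is the datum `φ`, `hφ` of ★ (G5-c) `Modules.homologyMap_bijective_of_refineCochain`; for `M = 𝒪_X` it is ★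
`pullbackSystemHom (𝟙 X)`. [cite: StacksProject, Tag 01FG] [cite: GortzWedhorn2023, Def. 21.68 (p. 180)] -/
theorem exists_sectionsSystem_restrictionHom :
    ∃ φ : OrderedCech.imageFunctor θ ⋙ sectionsSystem U M ρ ⟶ sectionsSystem V M ρ,
      ∀ (s' : Finset ι') (x : SecMod M ρ (cechOpen U (s'.image θ))),
        (φ.app s').hom x = SecMod.res M ρ (cechOpen_le_cechOpen_image U V θ hV s') x := by
  refine ⟨{ app := fun s' => ModuleCat.ofHom (SecMod.res M ρ (cechOpen_le_cechOpen_image U V θ hV s'))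
            naturality := fun s' t' h => ?_ }, fun s' x => rfl⟩
  ext x
  change SecMod.res M ρ (cechOpen_le_cechOpen_image U V θ hV t')
      (SecMod.res M ρ (cechOpen_anti U (Finset.image_subset_image h.le)) x) =
    SecMod.res M ρ (cechOpen_anti V h.le) (SecMod.res M ρ (cechOpen_le_cechOpen_image U V θ hV s') x)
  rw [SecMod.res_res, SecMod.res_res]

/-! ## §2 A refinement of affine-intersection covers induces `Ȟⁿ(𝓤, M) ≃ Ȟⁿ(𝓥, M)` -/

variable [Fintype ι] [Fintype ι'] (hUa : ∀ s : Finset ι, s.Nonempty → IsAffineOpen (cechOpen U s))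
  (hVa : ∀ s : Finset ι', s.Nonempty → IsAffineOpen (cechOpen V s))
  (hUcov : ⨆ i, U i = ⊤) (hVcov : ⨆ j, V j = ⊤) (hM : IsAffineLocalizing M)

include hV hUa hVa hUcov hVcov hM in
/-- **Refinement invariance of `Ȟⁿ(𝓤, M)`**: for finite covers `𝓤`, `𝓥` of `X` with affine non-empty finite intersections, `𝓥` refining `𝓤`
along any `θ`, and `M` affine-localizing, the refinement map ★ `refineComplexMap θ φ` (`φ` the restriction datum of §1) is an `A`-linear
isomorphism `Ȟⁿ(𝓤, M) ≃ Ȟⁿ(𝓥, M)` for every `n : ℤ` (★ (G5-c): both sides compute `Hⁿ(X, M)`).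
[cite: StacksProject, Tag 01XD] [cite: StacksProject, Tag 01FG] [cite: GortzWedhorn2023, Thm. 22.9 (p. 236)] [cite: Hartshorne1977, III Thm. 4.5] -/
theorem nonempty_homology_linearEquiv_of_refines (n : ℤ) :
    Nonempty (((cechComplex U M ρ).homology n : Type) ≃ₗ[A] ((cechComplex V M ρ).homology n : Type)) := by
  obtain ⟨φ, hφ⟩ := exists_sectionsSystem_restrictionHom U V M ρ θ hV
  have hbij := homologyMap_bijective_of_refineCochain U V M ρ θ hV φ hφ hUa hVa hUcov hVcov hM
    (OrderedCech.refineComplexMap θ φ) (fun n g => OrderedCech.refineComplexMap_f_apply _ _ n g) n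
  exact ⟨LinearEquiv.ofBijective _ hbij⟩

include hV hUa hVa hUcov hVcov hM in
/-- `Ȟⁿ(𝓤, M) = 0 ↔ Ȟⁿ(𝓥, M) = 0` for a refinement of affine-intersection covers (`nonempty_homology_linearEquiv_of_refines`).
[cite: StacksProject, Tag 01XD] [cite: Hartshorne1977, III Thm. 4.5] -/
theorem subsingleton_homology_iff_of_refines (n : ℤ) :
    Subsingleton ((cechComplex U M ρ).homology n) ↔ Subsingleton ((cechComplex V M ρ).homology n) := by
  obtain ⟨e⟩ := nonempty_homology_linearEquiv_of_refines U V M ρ θ hV hUa hVa hUcov hVcov hM n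
  exact ⟨fun _ => e.symm.injective.subsingleton, fun _ => e.injective.subsingleton⟩

/-! ## §3 Two covers with a common refinement; transport along an isomorphism of modules -/

variable {ι'' : Type} [LinearOrder ι''] [Fintype ι''] (U' : ι'' → X.Opens)
  (hU'a : ∀ s : Finset ι'', s.Nonempty → IsAffineOpen (cechOpen U' s)) (hU'cov : ⨆ i, U' i = ⊤)
  (θ₁ : ι' → ι) (θ₂ : ι' → ι'') (h₁ : ∀ j, V j ≤ U (θ₁ j)) (h₂ : ∀ j, V j ≤ U' (θ₂ j))

include hUa hVa hUcov hVcov hM hU'a hU'cov h₁ h₂ in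
/-- **Two affine-intersection covers with a common refinement have isomorphic `Ȟⁿ(–, M)`**: for finite covers `𝓤` (on `ι`), `𝓤′` (on `ι″`)
and `𝓥` (on `ι′`) of `X`, all with affine non-empty finite intersections, `𝓥` refining `𝓤` along `θ₁` and `𝓤′` along `θ₂`, and `M`
affine-localizing: `Ȟⁿ(𝓤, M) ≃ₗ[A] Ȟⁿ(𝓤′, M)` (through `Ȟⁿ(𝓥, M)`, §2 twice).  [cite: Hartshorne1977, III Lemma 4.4 and Thm. 4.5 (pp. 220–222)]
[cite: StacksProject, Tag 01XD] [cite: GortzWedhorn2023, Thm. 22.9 (p. 236)] -/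
theorem nonempty_homology_linearEquiv_of_common_refinement (n : ℤ) :
    Nonempty (((cechComplex U M ρ).homology n : Type) ≃ₗ[A] ((cechComplex U' M ρ).homology n : Type)) := by
  obtain ⟨e₁⟩ := nonempty_homology_linearEquiv_of_refines U V M ρ θ₁ h₁ hUa hVa hUcov hVcov hM n
  obtain ⟨e₂⟩ := nonempty_homology_linearEquiv_of_refines U' V M ρ θ₂ h₂ hU'a hVa hU'cov hVcov hM n
  exact ⟨e₁.trans e₂.symm⟩

include hUa hVa hUcov hVcov hM hU'a hU'cov h₁ h₂ in
/-- **`Ȟⁿ(𝓤, M) ≃ₗ[A] Ȟⁿ(𝓤′, M′)` for `M ≅ M′` and two affine-intersection covers with a common refinement** (§3 for `M`, then ★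
`Modules.sectionsSystemIsoOfIso`: `Č(𝓤′, M) ≅ Č(𝓤′, M′)`).  The form consumed by the D1 road: ONE module up to isomorphism
(`p₂^*L ≅ p₁^*L⁻¹ ⊗ m^*L` on `A × A`, [MumfordAV1970] §8 (iii)) read on the two product covers of `A × A`.
[cite: Hartshorne1977, III Lemma 4.4 and Thm. 4.5 (pp. 220–222)] [cite: StacksProject, Tag 01XD] [cite: MumfordAV1970, §8 (vii) (p. 76)] -/
theorem nonempty_homology_linearEquiv_of_iso_of_common_refinement {M' : X.Modules} (e : M ≅ M') (n : ℤ) :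
    Nonempty (((cechComplex U M ρ).homology n : Type) ≃ₗ[A] ((cechComplex U' M' ρ).homology n : Type)) := by
  obtain ⟨e₁⟩ := nonempty_homology_linearEquiv_of_common_refinement U V M ρ hUa hVa hUcov hVcov hM U' hU'a hU'cov θ₁ θ₂ h₁ h₂ n
  exact ⟨e₁.trans ((HomologicalComplex.homologyFunctor _ _ n).mapIso (sectionsSystemIsoOfIso U' e ρ)).toLinearEquiv⟩

include hUa hVa hUcov hVcov hM hU'a hU'cov h₁ h₂ in
/-- `Ȟⁿ(𝓤′, M′) = 0 ⇒ Ȟⁿ(𝓤, M) = 0` for `M ≅ M′` and two affine-intersection covers with a common refinement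
(`nonempty_homology_linearEquiv_of_iso_of_common_refinement`). [cite: Hartshorne1977, III Thm. 4.5] [cite: MumfordAV1970, §8 (vii) (p. 76)] -/
theorem subsingleton_homology_of_iso_of_common_refinement {M' : X.Modules} (e : M ≅ M') (n : ℤ)
    [Subsingleton ((cechComplex U' M' ρ).homology n)] : Subsingleton ((cechComplex U M ρ).homology n) := by
  obtain ⟨e₁⟩ := nonempty_homology_linearEquiv_of_iso_of_common_refinement U V M ρ hUa hVa hUcov hVcov hM U' hU'a hU'cov θ₁ θ₂
    h₁ h₂ e n
  exact e₁.injective.subsingleton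

end Literature.AlgebraicGeometry.Modules

end
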